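import Summits.CriticalPhenomena.PercolationContinuityZ3.Theorems.Transplant.SkelPhiCellsWeakG
import HarnessLib

/-!
# N1 ({±1} node) fine cells: the CANONICAL REPRESENTATIVE of a fine cell (one multiplier per axis) and the COLUMN POINT `hcol` of `sepGeomSG₂` for the
# fine cell map (hp-8 g33)

builds on p205010 (kernel theorem, internal audit signed; external expert review pending) — nothing in this file uses p205010; nothing here is a
claim about the open node `SamePDropOfSkeletonNeg`.
Lane `prim-bschramm`, seat `prim-hp-8` (gen 33); helper file (`--supports stmt-CriticalPhenomena-4575 --as helper`).
The fine skeleton `fineSkel φ t A n h vα vβ c₀ c₁ (D/2) (D/2) D` hits every fine cell `z`: the planar point `rep₂ z := round(A·(z₀·u/c₀ + z₁·v/c₁))`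
(`u = (n,h)`, `v = (vα,vβ)`; generalises `TwoAxis.Para.rep`, the case `c₀ = c₁`) satisfies `⌊(c_i·λ_i(rep₂ z) + D/2)/D⌋ = z_i` as soon as `c_i·L_i + 2 ≤ D`
(`L₀ = |A|(|vβ|+|vα|)`, `L₁ = |A|(|n|+|h|)`; the two units of room absorb the rounding at a cell boundary — the params column defines `m_i := ⌊(D−2)/(20K·L_i)⌋`).
With `Steps` of `φ` a VERTEX over `φ t + rep₂ z` exists near `t` (`exists_mem_graphBall_fineSkel_eq`), and with weak steps it lies in the span of any window
around its cell — the hypothesis `hcol` of `sepGeomSG₂` (`hcol_fineSkel`, radius slot `Nrep`).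
* §1 `rep₂`, `mul_lam0_rep₂`, `mul_lam1_rep₂`, `rep₂_err`, **`fine_rep`**; §2 **`exists_mem_graphBall_fineSkel_eq`**, **`hcol_fineSkel`**.
[cite: MartineauTassion2017, §4.3 (boxes on the lattice z₁u + z₂v)] [cite: KozmaNitzan2024, §4 p. 26 ((29): columns)]
-/

namespace Summit.CriticalPhenomena.PercolationContinuityZ3.Theorems.Transplant

open Literature.Probability.LatticeModels

namespace TwoAxis.Para

/-! ## §1 The canonical representative of a fine cell -/

/-- **Canonical planar representative of the fine cell `z`**: `round(A(z₀ u/c₀ + z₁ v/c₁))` componentwise, common denominator `c₀c₁`. [this work] -/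
def rep₂ (A n h vα vβ c₀ c₁ : ℤ) (z : Site 2) : Site 2 :=
  ![rdiv (A * (z 0 * n * c₁ + z 1 * vα * c₀)) (c₀ * c₁), rdiv (A * (z 0 * h * c₁ + z 1 * vβ * c₀)) (c₀ * c₁)]

/-- `c₁·(c₀·λ₀(rep₂ z)) = c₁·D·z₀ + A(vβ·e₀ − vα·e₁)` with the rounding errors `e_i = c₀c₁·rep₂_i − A(…)`. [folklore] -/
theorem mul_lam0_rep₂ (A n h vα vβ c₀ c₁ : ℤ) (z : Site 2) :
    c₁ * (c₀ * lam0 A vα vβ (rep₂ A n h vα vβ c₀ c₁ z)) =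
      c₁ * (detD A n h vα vβ * z 0) +
        A * (vβ * (c₀ * c₁ * rep₂ A n h vα vβ c₀ c₁ z 0 - A * (z 0 * n * c₁ + z 1 * vα * c₀)) -
          vα * (c₀ * c₁ * rep₂ A n h vα vβ c₀ c₁ z 1 - A * (z 0 * h * c₁ + z 1 * vβ * c₀))) := by
  unfold lam0 detD modulus; ring

/-- `c₀·(c₁·λ₁(rep₂ z)) = c₀·D·z₁ + A(n·e₁ − h·e₀)`. [folklore] -/
theorem mul_lam1_rep₂ (A n h vα vβ c₀ c₁ : ℤ) (z : Site 2) :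
    c₀ * (c₁ * lam1 A n h (rep₂ A n h vα vβ c₀ c₁ z)) =
      c₀ * (detD A n h vα vβ * z 1) +
        A * (n * (c₀ * c₁ * rep₂ A n h vα vβ c₀ c₁ z 1 - A * (z 0 * h * c₁ + z 1 * vβ * c₀)) -
          h * (c₀ * c₁ * rep₂ A n h vα vβ c₀ c₁ z 0 - A * (z 0 * n * c₁ + z 1 * vα * c₀))) := by
  unfold lam1 bp detD modulus; ring

/-- The two rounding errors of `rep₂` are at most `c₀c₁/2` (doubled form), `0 < c₀c₁`. [folklore] -/
theorem rep₂_err {A n h vα vβ c₀ c₁ : ℤ} (hc : 0 < c₀ * c₁) (z : Site 2) :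
    2 * |c₀ * c₁ * rep₂ A n h vα vβ c₀ c₁ z 0 - A * (z 0 * n * c₁ + z 1 * vα * c₀)| ≤ c₀ * c₁ ∧
      2 * |c₀ * c₁ * rep₂ A n h vα vβ c₀ c₁ z 1 - A * (z 0 * h * c₁ + z 1 * vβ * c₀)| ≤ c₀ * c₁ := by
  unfold rep₂
  simp only [Matrix.cons_val_zero, Matrix.cons_val_one]
  exact ⟨two_mul_abs_sub_le hc, two_mul_abs_sub_le hc⟩

/-- **The representative lies in its fine cell**: `⌊(c_i·λ_i(rep₂ z) + D/2)/D⌋ = z_i` (`i = 0,1`) for `0 < c₀, c₁`, `0 < D`, `c₀·L₀ + 2 ≤ D`, `c₁·L₁ + 2 ≤ D`.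
[cite: MartineauTassion2017, §4.3] -/
theorem fine_rep {A n h vα vβ c₀ c₁ : ℤ} (hc₀ : 0 < c₀) (hc₁ : 0 < c₁) (hD : 0 < detD A n h vα vβ)
    (hL0 : c₀ * (|A| * (|vβ| + |vα|)) + 2 ≤ detD A n h vα vβ) (hL1 : c₁ * (|A| * (|n| + |h|)) + 2 ≤ detD A n h vα vβ) (z : Site 2) :
    coarse c₀ (detD A n h vα vβ / 2) (detD A n h vα vβ) (lam0 A vα vβ (rep₂ A n h vα vβ c₀ c₁ z)) = z 0 ∧
      coarse c₁ (detD A n h vα vβ / 2) (detD A n h vα vβ) (lam1 A n h (rep₂ A n h vα vβ c₀ c₁ z)) = z 1 := by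
  set D := detD A n h vα vβ with hDdef
  have hc : 0 < c₀ * c₁ := mul_pos hc₀ hc₁
  obtain ⟨he0, he1⟩ := rep₂_err (A := A) (n := n) (h := h) (vα := vα) (vβ := vβ) hc z
  set e₀ := c₀ * c₁ * rep₂ A n h vα vβ c₀ c₁ z 0 - A * (z 0 * n * c₁ + z 1 * vα * c₀) with he₀
  set e₁ := c₀ * c₁ * rep₂ A n h vα vβ c₀ c₁ z 1 - A * (z 0 * h * c₁ + z 1 * vβ * c₀) with he₁
  -- the half offset
  have hs := Int.mul_ediv_add_emod D 2
  have hs0 := Int.emod_nonneg D (by norm_num : (2 : ℤ) ≠ 0)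
  have hs1 := Int.emod_lt_of_pos D (by norm_num : (0 : ℤ) < 2)
  constructor
  · -- `c₁·(c₀λ₀ − D z₀) = A(vβ e₀ − vα e₁)`, `2|…| ≤ L₀·c₀c₁`, so `2|c₀λ₀ − D z₀| ≤ c₀ L₀ ≤ D − 2`
    have hid := mul_lam0_rep₂ A n h vα vβ c₀ c₁ z
    have herr := two_mul_abs_comb_le (A := A) (p := vβ) (q := vα) he0 he1
    -- clear the factor `c₁`
    set X := c₀ * lam0 A vα vβ (rep₂ A n h vα vβ c₀ c₁ z) - D * z 0 with hX
    have hXe : c₁ * X = A * (vβ * e₀ - vα * e₁) := by rw [hX, mul_sub]; linarith [hid]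
    have habs : |c₁ * X| = c₁ * |X| := by rw [abs_mul, abs_of_pos hc₁]
    have key : c₁ * (2 * |X|) ≤ c₁ * (c₀ * (|A| * (|vβ| + |vα|))) := by
      have e1 : c₁ * (2 * |X|) = 2 * |c₁ * X| := by rw [habs]; ring
      have e2 : c₁ * (c₀ * (|A| * (|vβ| + |vα|))) = |A| * (|vβ| + |vα|) * (c₀ * c₁) := by ring
      rw [e1, e2, hXe]; exact herr
    have key' : 2 * |X| ≤ c₀ * (|A| * (|vβ| + |vα|)) := le_of_mul_le_mul_left key hc₁
    have hb := abs_le.1 (show |X| ≤ (D - 2) / 2 by omega)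
    have hdiv2 := Int.mul_ediv_add_emod (D - 2) 2
    have hdiv20 := Int.emod_nonneg (D - 2) (by norm_num : (2 : ℤ) ≠ 0)
    have hdiv21 := Int.emod_lt_of_pos (D - 2) (by norm_num : (0 : ℤ) < 2)
    rw [hX] at hb
    unfold coarse
    apply ediv_eq_of_bounds hD <;> linarith [hb.1, hb.2]
  · have hid := mul_lam1_rep₂ A n h vα vβ c₀ c₁ z
    have herr := two_mul_abs_comb_le (A := A) (p := n) (q := h) he1 he0
    set X := c₁ * lam1 A n h (rep₂ A n h vα vβ c₀ c₁ z) - D * z 1 with hX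
    have hXe : c₀ * X = A * (n * e₁ - h * e₀) := by rw [hX, mul_sub]; linarith [hid]
    have habs : |c₀ * X| = c₀ * |X| := by rw [abs_mul, abs_of_pos hc₀]
    have key : c₀ * (2 * |X|) ≤ c₀ * (c₁ * (|A| * (|n| + |h|))) := by
      have e1 : c₀ * (2 * |X|) = 2 * |c₀ * X| := by rw [habs]; ring
      have e2 : c₀ * (c₁ * (|A| * (|n| + |h|))) = |A| * (|n| + |h|) * (c₀ * c₁) := by ring
      rw [e1, e2, hXe]; exact herr
    have key' : 2 * |X| ≤ c₁ * (|A| * (|n| + |h|)) := le_of_mul_le_mul_left key hc₀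
    have hb := abs_le.1 (show |X| ≤ (D - 2) / 2 by omega)
    have hdiv2 := Int.mul_ediv_add_emod (D - 2) 2
    have hdiv20 := Int.emod_nonneg (D - 2) (by norm_num : (2 : ℤ) ≠ 0)
    have hdiv21 := Int.emod_lt_of_pos (D - 2) (by norm_num : (0 : ℤ) < 2)
    rw [hX] at hb
    unfold coarse
    apply ediv_eq_of_bounds hD <;> linarith [hb.1, hb.2]

end TwoAxis.Para

/-! ## §2 The column point of the fine cell map -/

namespace Skelφ

open Literature.Probability.Percolation.KozmaNitzan.Cells (oth)
open Literature.Barriers.CriticalPhenomena (graphBall mem_graphBall_self graphBall_mono)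
open TwoAxis.Para (coarse lam0 lam1 detD rep₂)

variable {V : Type} [DecidableEq V] {G : SimpleGraph V} [G.LocallyFinite] {φ : V → Site 2}

omit [DecidableEq V] [G.LocallyFinite] in
/-- **FINE STEPS**: from `t`, a vertex at graph distance `≤ ‖rep₂ z‖₁` whose fine-cell position is exactly `z` (under `Steps` of `φ` and the room
`c_i·L_i + 2 ≤ D`, offsets `D/2`). [cite: KozmaNitzan2024, §4 Lemma 10 Step IV (pp. 20–21)] -/
theorem exists_mem_graphBall_fineSkel_eq (hstep : Steps G φ) (t : V) {A n h vα vβ c₀ c₁ : ℤ} (hc₀ : 0 < c₀) (hc₁ : 0 < c₁)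
    (hD : 0 < detD A n h vα vβ) (hL0 : c₀ * (|A| * (|vβ| + |vα|)) + 2 ≤ detD A n h vα vβ)
    (hL1 : c₁ * (|A| * (|n| + |h|)) + 2 ≤ detD A n h vα vβ) (z : Site 2) :
    ∃ g, g ∈ graphBall G t ((rep₂ A n h vα vβ c₀ c₁ z 0).natAbs + (rep₂ A n h vα vβ c₀ c₁ z 1).natAbs) ∧
      fineSkel φ t A n h vα vβ c₀ c₁ (detD A n h vα vβ / 2) (detD A n h vα vβ / 2) (detD A n h vα vβ) g = z := by
  obtain ⟨g, hg, hφ⟩ := exists_mem_graphBall_φ_eq hstep t (φ t + rep₂ A n h vα vβ c₀ c₁ z)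
  refine ⟨g, ?_, ?_⟩
  · simpa using hg
  · have hrel : relφ φ t g = rep₂ A n h vα vβ c₀ c₁ z := by
      funext i; simp [relφ, hφ]
    obtain ⟨h0, h1⟩ := TwoAxis.Para.fine_rep hc₀ hc₁ hD hL0 hL1 z
    funext i
    fin_cases i
    · show fineSkel φ t A n h vα vβ c₀ c₁ (detD A n h vα vβ / 2) (detD A n h vα vβ / 2) (detD A n h vα vβ) g 0 = z 0
      rw [fineSkel_apply_zero, hrel]; exact h0
    · show fineSkel φ t A n h vα vβ c₀ c₁ (detD A n h vα vβ / 2) (detD A n h vα vβ / 2) (detD A n h vα vβ) g 1 = z 1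
      rw [fineSkel_apply_one, hrel]; exact h1

/-- **THE COLUMN POINT `hcol` of `sepGeomSG₂` for the fine cell map**: for every cube `Q x` there is a vertex of fine position exactly `cen x` inside the
window span `VWin (Q x) R`, as soon as `R ≥ ‖rep₂ (cen x)‖₁ + 1` (room for one weak step) — the `Nrep`/`colQ` slot of the schedule.
[cite: KozmaNitzan2024, §4 p. 26 ((29): columns)] -/
theorem hcol_fineSkel (hlip : Lip G φ) (hstep : Steps G φ) (t : V) {A n h vα vβ c₀ c₁ : ℤ} (hc₀ : 0 < c₀) (hc₁ : 0 < c₁)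
    (hD : 0 < detD A n h vα vβ) (hL0 : c₀ * (|A| * (|vβ| + |vα|)) + 2 ≤ detD A n h vα vβ)
    (hL1 : c₁ * (|A| * (|n| + |h|)) + 2 ≤ detD A n h vα vβ) (P : PCells2) (x : Site 2) {R : ℕ}
    (hR : (rep₂ A n h vα vβ c₀ c₁ (P.cen x) 0).natAbs + (rep₂ A n h vα vβ c₀ c₁ (P.cen x) 1).natAbs + 1 ≤ R) :
    ∃ y ∈ VWin G (fineSkel φ t A n h vα vβ c₀ c₁ (detD A n h vα vβ / 2) (detD A n h vα vβ / 2) (detD A n h vα vβ)) t (P.Q x) R,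
      fineSkel φ t A n h vα vβ c₀ c₁ (detD A n h vα vβ / 2) (detD A n h vα vβ / 2) (detD A n h vα vβ) y = P.cen x := by
  obtain ⟨g, hg, hgz⟩ := exists_mem_graphBall_fineSkel_eq hstep t hc₀ hc₁ hD hL0 hL1 (P.cen x)
  have hlipψ : Lip G (fineSkel φ t A n h vα vβ c₀ c₁ (detD A n h vα vβ / 2) (detD A n h vα vβ / 2) (detD A n h vα vβ)) :=
    lip_fineSkel hlip t hc₀.le hc₁.le hD (by linarith) (by linarith)
  -- a weak-step neighbour stays in the cube `Q x` (its centre ± 1)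
  obtain ⟨m, hadj, -⟩ := weakSteps_fineSkel hstep t hD hc₀.le hc₁.le (A := A) (n := n) (h := h) (vα := vα) (vβ := vβ)
    (s₀ := detD A n h vα vβ / 2) (s₁ := detD A n h vα vβ / 2) g 0 1
  have hQ : ∀ s : Site 2, (∀ i, |s i - P.cen x i| ≤ 1) → s ∈ P.Q x := fun s hs => by
    rw [PCells2.Q, PCells2.mem_abox_iff]
    intro i
    have := abs_le.1 (hs i); have := P.one_le_r i
    push_cast; constructor <;> omega
  have hgQ : fineSkel φ t A n h vα vβ c₀ c₁ (detD A n h vα vβ / 2) (detD A n h vα vβ / 2) (detD A n h vα vβ) g ∈ P.Q x :=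
    hQ _ fun i => by rw [hgz]; simp
  have hmQ : fineSkel φ t A n h vα vβ c₀ c₁ (detD A n h vα vβ / 2) (detD A n h vα vβ / 2) (detD A n h vα vβ) m ∈ P.Q x :=
    hQ _ fun i => by
      have := hlipψ hadj i
      rw [hgz] at this
      rw [abs_sub_comm]; exact this
  exact ⟨g, mem_VWin_of_adj hg hR hgQ hadj hmQ, hgz⟩

end Skelφ

end Summit.CriticalPhenomena.PercolationContinuityZ3.Theorems.Transplant
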